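import Summits.FinalStateConjecture.FinalStateConjecture.Theorems.PhaseMixingCaptureCaptureSufficesReduction
import Summits.FinalStateConjecture.FinalStateConjecture.Theorems.BulkKerrCapture.Negative.DegenerateCentres
import Summits.FinalStateConjecture.FinalStateConjecture.Theorems.NearExtremalKappaCapture.Negative.ExponentMonotonicity
import HarnessLib

/-!
# `BulkKerrCaptureC2` — block form, prefix structure, centre, and what is load-bearing

Negative-side lemmas for the crux `stmt-FinalStateConjecture-14985`
(`Summit.FinalStateConjecture.FinalStateConjecture.Theses.PhaseMixingCapture.BulkKerrCaptureC2`, rank 4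
of `route-FinalStateConjecture-PhaseMixingCapture`; the import-grade successor of `BulkKerrCapture`
with the b-conormality side condition, the qualitative modulus `∀ η ∃ ε` and the convergence order
PINNED to `k = 2`), written by the standing disprover (`cdisprove`, cycle 1, 2026-08-16). Nothing
here asserts the crux; every statement is an equivalence, a consequence OF the crux, or a
conditional refutation of a VARIANT of the crux.

## Contents

* §1 `CaptureC2At s δ M hM ε η a` — the conclusion block of the crux with its parameters exposed,
  and `bulkKerrCaptureC2_iff_captureC2At` (the crux ↔ its block form; the inlined sojourn clause is
  `DataEmbedding.HasCompleteFutureNullInfinityFar`, via the tree lemma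
  `PhaseMixingCaptureCaptureSuffices.bulkKerrCaptureC2_iff`).
* §2 prefix structure: `CaptureC2At.mono` (up-set in `(s, δ)`, antitone in `ε`, monotone in `η`),
  `bulkKerrCaptureC2_iff_nonneg` (WLOG `0 ≤ a₁`), `bulkKerrCaptureC2_iff_normalForm` (WLOG
  `s ≥ s₀`, `δ ≥ δ₀`, `ε ≤ 1`, `η ≤ η₀`), `captureC2Threshold_anti` / `bulkKerrCaptureC2_iff_seq`
  (the crux is the countable conjunction of its members `a₁ = 1 − 1/(n+1)`).
* §3 the centre of the ball: `captureC2At_atKerrData`, `bulkKerrCaptureC2_atKerrData`,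
  `bulkKerrCaptureC2_atSchwarzschildData` — at exact Kerr data the crux predicts, for EVERY
  tolerance `η`, SOME `η`-close sub-extremal `C²`-limit; the final parameters are NOT pinned.
* §4 degenerate centres: `subextremal_near_of_abs_le` — at the extremal centre `|a| = M` and at the
  massless centre `M = 0` the parameter clause of the conclusion is CONSISTENT for every `η > 0`, so
  the pinning refutations of the predecessor crux
  (`BulkKerrCapture.Negative.captureAt_noMGHD_of_not_isSubextremal`) do NOT port to the `∀ η ∃ ε`
  typing; only a SUPER-extremal centre `M < |a|` is still excluded by counting
  (`not_exists_subextremal_near_of_lt`).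
* (sequel `…/Negative/LoadBearing.lean`) §5 the two one-hypothesis weakenings of the crux refuted
  modulo named facts, §6 kill templates.
-/


-- the doubled `FinalStateConjecture.FinalStateConjecture` path component trips dupNamespace
set_option linter.dupNamespace false

noncomputable section

open Set Filter Topology Function
open scoped Manifold ContDiff ENNReal Topology
open Literature.Geometry.Lorentzian
open Summit.FinalStateConjecture.FinalStateConjecture.Theses.PhaseMixingCapture (BulkKerrCaptureC2)
open Summit.FinalStateConjecture.FinalStateConjecture.Theorems.BulkKerrCapture

namespace Summit.FinalStateConjecture.FinalStateConjecture.Theorems.BulkKerrCaptureC2.Negative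

/-! ## §1 The conclusion block with parameters exposed -/

/-- `CaptureC2At s δ M hM ε η a`: every vacuum-constraint solution `D` on `Kerr.slice a M` which is
b-conormal relative to `Kerr.data M a M` at weight `δ` (finite `H^{s'}_δ`-distance at every order
`s'`) and within `H^s_δ`-distance `ε` of it has all its maximal vacuum Cauchy developments
far-complete (`DataEmbedding.HasCompleteFutureNullInfinityFar`), with a region converging in `C²`
to a sub-extremal `g_{M',a'}`, `|M' − M| + |a' − a| ≤ η`. The matrix of the crux
`BulkKerrCaptureC2`; a parametrised predicate, not a named fact. [folklore] -/
def CaptureC2At [Kerr.Facts] [Kerr.SliceFacts] (s : ℕ) (δ : ℝ) (M : ℝ) (hM : 0 ≤ M)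
    (ε η a : ℝ) : Prop :=
  ∀ (D : InitialDataSet 𝓘(ℝ, E3) (Kerr.slice a M)) [D.metric.HasLeviCivita],
    D.IsVacuumConstraintSolution →
    (∀ s' : ℕ, InitialDataSet.dataWeightedSobolevEDist s' δ D (Kerr.data M a M hM) < ⊤) →
    InitialDataSet.dataWeightedSobolevEDist s δ D (Kerr.data M a M hM) < ENNReal.ofReal ε →
    ∀ 𝒟 : VacuumCauchyDevelopment D, 𝒟.IsMaximal →
      ∃ (M' a' : ℝ) (𝒟oc : Set 𝒟.carrier), Kerr.IsSubextremal M' a' ∧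
        𝒟.HasCompleteFutureNullInfinityFar ∧
        𝒟.toSpacetime.ConvergesToKerr 𝒟oc M' a' 2 ∧ |M' - M| + |a' - a| ≤ η

/-- **The crux in block form**: `BulkKerrCaptureC2` iff for every `a₁ < 1` there are `(s, δ)` and,
per mass `M > 0` and tolerance `η > 0`, one basin `ε > 0` with `CaptureC2At s δ M _ ε η a` for every
`|a| ≤ a₁ M` (the tree lemma `PhaseMixingCaptureCaptureSuffices.bulkKerrCaptureC2_iff` read through
`CaptureC2At`). [folklore] -/
theorem bulkKerrCaptureC2_iff_captureC2At :
    BulkKerrCaptureC2 ↔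
      ∀ [Kerr.Facts] [Kerr.SliceFacts], ∀ a₁ : ℝ, a₁ < 1 → ∃ (s : ℕ) (δ : ℝ),
        ∀ (M : ℝ) (hM : 0 < M), ∀ η > (0 : ℝ), ∃ ε > (0 : ℝ), ∀ a : ℝ, |a| ≤ a₁ * M →
          CaptureC2At s δ M hM.le ε η a := by
  rw [PhaseMixingCaptureCaptureSuffices.bulkKerrCaptureC2_iff]
  rfl

/-! ## §2 Structure of the quantifier prefix -/

/-- **Monotonicity of the block.** `CaptureC2At` is an up-set in `(s, δ)` (raising the order or
the weight shrinks the data class: the data distance is monotone in both exponents,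
`NearExtremalKappaCapture.Negative.dataWeightedSobolevEDist_mono`), antitone in the basin `ε` and
monotone in the tolerance `η`. [folklore] -/
theorem CaptureC2At.mono [Kerr.Facts] [Kerr.SliceFacts] {s s' : ℕ} {δ δ' : ℝ} {M : ℝ}
    {hM : 0 ≤ M} {ε ε' η η' a : ℝ} (h : CaptureC2At s δ M hM ε η a) (hs : s ≤ s') (hδ : δ ≤ δ')
    (hε : ε' ≤ ε) (hη : η ≤ η') : CaptureC2At s' δ' M hM ε' η' a := by
  intro D _ hvac hcon hdist 𝒟 hmax
  have hcon' : ∀ s'' : ℕ,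
      InitialDataSet.dataWeightedSobolevEDist s'' δ D (Kerr.data M a M hM) < ⊤ := fun s'' ↦
    lt_of_le_of_lt
      (NearExtremalKappaCapture.Negative.dataWeightedSobolevEDist_mono le_rfl hδ D _) (hcon s'')
  have hdist' : InitialDataSet.dataWeightedSobolevEDist s δ D (Kerr.data M a M hM) <
      ENNReal.ofReal ε :=
    lt_of_le_of_lt (NearExtremalKappaCapture.Negative.dataWeightedSobolevEDist_mono hs hδ D _)
      (hdist.trans_le (ENNReal.ofReal_le_ofReal hε))
  obtain ⟨M', a', 𝒟oc, hsub, hfar, hconv, hpar⟩ := h D hvac hcon' hdist' 𝒟 hmax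
  exact ⟨M', a', 𝒟oc, hsub, hfar, hconv, hpar.trans hη⟩

/-- WLOG `0 ≤ a₁`: the crux is equivalent to its restriction to thresholds `a₁ ∈ [0, 1)` (for
`a₁ < 0` the spin range `|a| ≤ a₁ M`, `M > 0`, is empty: `BulkKerrCapture.Negative.no_spin_of_neg`).
[folklore] -/
theorem bulkKerrCaptureC2_iff_nonneg :
    BulkKerrCaptureC2 ↔
      ∀ [Kerr.Facts] [Kerr.SliceFacts], ∀ a₁ : ℝ, 0 ≤ a₁ → a₁ < 1 → ∃ (s : ℕ) (δ : ℝ),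
        ∀ (M : ℝ) (hM : 0 < M), ∀ η > (0 : ℝ), ∃ ε > (0 : ℝ), ∀ a : ℝ, |a| ≤ a₁ * M →
          CaptureC2At s δ M hM.le ε η a := by
  rw [bulkKerrCaptureC2_iff_captureC2At]
  constructor
  · intro h _ _ a₁ _ ha₁
    exact h a₁ ha₁
  · intro h _ _ a₁ ha₁
    rcases le_or_gt 0 a₁ with h0 | h0
    · exact h a₁ h0 ha₁
    · exact ⟨0, 0, fun M hM η _ ↦ ⟨1, one_pos, fun a ha ↦ (Negative.no_spin_of_neg h0 hM ha).elim⟩⟩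

/-- **Normal form.** For ANY prescribed `(s₀, δ₀)` and `η₀ > 0`, the crux is equivalent to its
restriction to exponents `s ≥ s₀`, `δ ≥ δ₀`, basins `ε ≤ 1` and SMALL tolerances `η ≤ η₀`: the
existential `(s, δ)` may be taken above any Sobolev/decay threshold (the crux IS its own
high-regularity, fast-decay member), and only small tolerances carry content. [folklore] -/
theorem bulkKerrCaptureC2_iff_normalForm (s₀ : ℕ) (δ₀ : ℝ) {η₀ : ℝ} (hη₀ : 0 < η₀) :
    BulkKerrCaptureC2 ↔
      ∀ [Kerr.Facts] [Kerr.SliceFacts], ∀ a₁ : ℝ, 0 ≤ a₁ → a₁ < 1 → ∃ s ≥ s₀, ∃ δ ≥ δ₀,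
        ∀ (M : ℝ) (hM : 0 < M), ∀ η : ℝ, 0 < η → η ≤ η₀ → ∃ ε > (0 : ℝ), ε ≤ 1 ∧
          ∀ a : ℝ, |a| ≤ a₁ * M → CaptureC2At s δ M hM.le ε η a := by
  rw [bulkKerrCaptureC2_iff_nonneg]
  constructor
  · intro h _ _ a₁ h0 ha₁
    obtain ⟨s, δ, hsδ⟩ := h a₁ h0 ha₁
    refine ⟨max s s₀, le_max_right _ _, max δ δ₀, le_max_right _ _, fun M hM η hη _ ↦ ?_⟩
    obtain ⟨ε, hε, hcap⟩ := hsδ M hM η hη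
    refine ⟨min ε 1, lt_min hε one_pos, min_le_right _ _, fun a ha ↦ ?_⟩
    exact (hcap a ha).mono (le_max_left _ _) (le_max_left _ _) (min_le_left _ _) le_rfl
  · intro h _ _ a₁ h0 ha₁
    obtain ⟨s, -, δ, -, hsδ⟩ := h a₁ h0 ha₁
    refine ⟨s, δ, fun M hM η hη ↦ ?_⟩
    obtain ⟨ε, hε, -, hcap⟩ := hsδ M hM (min η η₀) (lt_min hη hη₀) (min_le_right _ _)
    exact ⟨ε, hε, fun a ha ↦ (hcap a ha).mono le_rfl le_rfl le_rfl (min_le_left _ _)⟩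

/-- **The threshold is antitone**: the member of the crux at threshold `a₁` implies the member at
every `a₁' ≤ a₁` (same witnesses; the spin range shrinks). [folklore] -/
theorem captureC2Threshold_anti [Kerr.Facts] [Kerr.SliceFacts] {a₁ a₁' : ℝ} (hle : a₁' ≤ a₁)
    (h : ∃ (s : ℕ) (δ : ℝ), ∀ (M : ℝ) (hM : 0 < M), ∀ η > (0 : ℝ), ∃ ε > (0 : ℝ), ∀ a : ℝ,
      |a| ≤ a₁ * M → CaptureC2At s δ M hM.le ε η a) :
    ∃ (s : ℕ) (δ : ℝ), ∀ (M : ℝ) (hM : 0 < M), ∀ η > (0 : ℝ), ∃ ε > (0 : ℝ), ∀ a : ℝ,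
      |a| ≤ a₁' * M → CaptureC2At s δ M hM.le ε η a := by
  obtain ⟨s, δ, hsδ⟩ := h
  refine ⟨s, δ, fun M hM η hη ↦ ?_⟩
  obtain ⟨ε, hε, hcap⟩ := hsδ M hM η hη
  exact ⟨ε, hε, fun a ha ↦ hcap a (ha.trans (mul_le_mul_of_nonneg_right hle hM.le))⟩

/-- **Countable normal form.** The crux is the conjunction of its members at the thresholds
`a₁ = 1 − 1/(n+1)`, `n : ℕ` (antitonicity in the threshold and the Archimedean property): a proof
may proceed threshold by threshold along ANY sequence `a₁ ↑ 1`, and a disproof must defeat ONE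
threshold `a₁ < 1`. [folklore] -/
theorem bulkKerrCaptureC2_iff_seq :
    BulkKerrCaptureC2 ↔
      ∀ [Kerr.Facts] [Kerr.SliceFacts], ∀ n : ℕ, ∃ (s : ℕ) (δ : ℝ),
        ∀ (M : ℝ) (hM : 0 < M), ∀ η > (0 : ℝ), ∃ ε > (0 : ℝ), ∀ a : ℝ,
          |a| ≤ (1 - 1 / ((n : ℝ) + 1)) * M → CaptureC2At s δ M hM.le ε η a := by
  rw [bulkKerrCaptureC2_iff_captureC2At]
  constructor
  · intro h _ _ n
    refine h _ ?_
    have : (0 : ℝ) < 1 / ((n : ℝ) + 1) := by positivity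
    linarith
  · intro h _ _ a₁ ha₁
    obtain ⟨n, hn⟩ := exists_nat_one_div_lt (show 0 < 1 - a₁ by linarith)
    exact captureC2Threshold_anti (by linarith) (h n)

/-! ## §3 The centre of the ball -/

/-- **Centre of the ball.** `CaptureC2At … ε η a` with `ε > 0`, applied to the exact Kerr datum
(distance `0` to itself, b-conormal trivially), yields: every MGHD of `Kerr.data M a M` is
far-complete and has a region converging in `C²` to SOME sub-extremal `g_{M',a'}` with
`|M' − M| + |a' − a| ≤ η`. Unlike the predecessor crux (`BulkKerrCapture.Negative.captureAt_atKerrData`,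
modulus `C √dist`), the final parameters are NOT pinned to `(M, a)`. Only the vacuum constraints of
the one datum enter (`hvac`, the named fact `Kerr.data_isVacuumConstraintSolution` at `(M, a, M)`);
the Levi-Civita instance is the tree theorem `PseudoRiemannianMetric.hasLeviCivita`. [folklore] -/
theorem captureC2At_atKerrData [Kerr.Facts] [Kerr.SliceFacts] {s : ℕ} {δ : ℝ} {M : ℝ}
    {hM : 0 ≤ M} {ε η a : ℝ} (hε : 0 < ε) (h : CaptureC2At s δ M hM ε η a)
    (hvac : Kerr.data_isVacuumConstraintSolution M a M)
    (𝒟 : VacuumCauchyDevelopment (Kerr.data M a M hM)) (hmax : 𝒟.IsMaximal) :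
    𝒟.HasCompleteFutureNullInfinityFar ∧
      ∃ (M' a' : ℝ) (𝒟oc : Set 𝒟.carrier), Kerr.IsSubextremal M' a' ∧
        𝒟.toSpacetime.ConvergesToKerr 𝒟oc M' a' 2 ∧ |M' - M| + |a' - a| ≤ η := by
  haveI := (Kerr.data M a M hM).metric.hasLeviCivita
  have hcon : ∀ s' : ℕ, InitialDataSet.dataWeightedSobolevEDist s' δ (Kerr.data M a M hM)
      (Kerr.data M a M hM) < ⊤ := fun s' ↦ by
    rw [InitialDataSet.dataWeightedSobolevEDist_self]
    exact ENNReal.zero_lt_top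
  have h0 : InitialDataSet.dataWeightedSobolevEDist s δ (Kerr.data M a M hM)
      (Kerr.data M a M hM) < ENNReal.ofReal ε := by
    rw [InitialDataSet.dataWeightedSobolevEDist_self]
    exact ENNReal.ofReal_pos.2 hε
  obtain ⟨M', a', 𝒟oc, hsub, hfar, hconv, hpar⟩ := h _ (hvac hM) hcon h0 𝒟 hmax
  exact ⟨hfar, M', a', 𝒟oc, hsub, hconv, hpar⟩

/-- **The crux at the centre of its ball.** `BulkKerrCaptureC2` implies: for every `M > 0` and
every sub-extremal spin `|a| < M` (threshold `a₁ := |a|/M`), every MGHD of the exact Kerr datum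
on `{t* = 0, r > M}` is far-complete and, for EVERY tolerance `η > 0`, has a region converging in
`C²` to some sub-extremal `g_{M',a'}` with `|M' − M| + |a' − a| ≤ η` (the vacuum constraints of the
Kerr data enter as the hypothesis `hvac`, a named fact unproved in the tree for `a ≠ 0`). The
expected-true sanity statement at the centre; no refutation there. [folklore] -/
theorem bulkKerrCaptureC2_atKerrData (h : BulkKerrCaptureC2) [Kerr.Facts] [Kerr.SliceFacts]
    (hvac : ∀ M a r₀ : ℝ, Kerr.data_isVacuumConstraintSolution M a r₀) {M a : ℝ} (hM : 0 < M)
    (ha : Kerr.IsSubextremal M a) (𝒟 : VacuumCauchyDevelopment (Kerr.data M a M hM.le))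
    (hmax : 𝒟.IsMaximal) :
    𝒟.HasCompleteFutureNullInfinityFar ∧
      ∀ η > (0 : ℝ), ∃ (M' a' : ℝ) (𝒟oc : Set 𝒟.carrier), Kerr.IsSubextremal M' a' ∧
        𝒟.toSpacetime.ConvergesToKerr 𝒟oc M' a' 2 ∧ |M' - M| + |a' - a| ≤ η := by
  rw [bulkKerrCaptureC2_iff_captureC2At] at h
  have ha₁ : |a| / M < 1 := by
    rw [div_lt_one hM]
    exact ha
  obtain ⟨s, δ, hsδ⟩ := h (|a| / M) ha₁
  have hspin : |a| ≤ |a| / M * M := by rw [div_mul_cancel₀ _ hM.ne']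
  have key : ∀ η > (0 : ℝ), 𝒟.HasCompleteFutureNullInfinityFar ∧
      ∃ (M' a' : ℝ) (𝒟oc : Set 𝒟.carrier), Kerr.IsSubextremal M' a' ∧
        𝒟.toSpacetime.ConvergesToKerr 𝒟oc M' a' 2 ∧ |M' - M| + |a' - a| ≤ η := fun η hη ↦ by
    obtain ⟨ε, hε, hcap⟩ := hsδ M hM η hη
    exact captureC2At_atKerrData hε (hcap a hspin) (hvac M a M) 𝒟 hmax
  exact ⟨(key 1 one_pos).1, fun η hη ↦ (key η hη).2⟩

/-- **The crux at the Schwarzschild centre, with NO named-fact hypothesis**: the `a = 0`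
constraints are the tree theorem `Kerr.data_isVacuumConstraintSolution_zero`. For every `M > 0`,
every MGHD of the Schwarzschild datum on `{t* = 0, r > M}` is far-complete and, for every `η > 0`,
`C²`-converges on some region to some sub-extremal `g_{M',a'}` with `|M' − M| + |a'| ≤ η`. [folklore] -/
theorem bulkKerrCaptureC2_atSchwarzschildData (h : BulkKerrCaptureC2) [Kerr.Facts]
    [Kerr.SliceFacts] {M : ℝ} (hM : 0 < M)
    (𝒟 : VacuumCauchyDevelopment (Kerr.data M 0 M hM.le)) (hmax : 𝒟.IsMaximal) :
    𝒟.HasCompleteFutureNullInfinityFar ∧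
      ∀ η > (0 : ℝ), ∃ (M' a' : ℝ) (𝒟oc : Set 𝒟.carrier), Kerr.IsSubextremal M' a' ∧
        𝒟.toSpacetime.ConvergesToKerr 𝒟oc M' a' 2 ∧ |M' - M| + |a' - 0| ≤ η := by
  rw [bulkKerrCaptureC2_iff_captureC2At] at h
  obtain ⟨s, δ, hsδ⟩ := h 0 one_pos
  have hspin : |(0 : ℝ)| ≤ 0 * M := by simp
  have key : ∀ η > (0 : ℝ), 𝒟.HasCompleteFutureNullInfinityFar ∧
      ∃ (M' a' : ℝ) (𝒟oc : Set 𝒟.carrier), Kerr.IsSubextremal M' a' ∧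
        𝒟.toSpacetime.ConvergesToKerr 𝒟oc M' a' 2 ∧ |M' - M| + |a' - 0| ≤ η := fun η hη ↦ by
    obtain ⟨ε, hε, hcap⟩ := hsδ M hM η hη
    exact captureC2At_atKerrData hε (hcap 0 hspin) (Kerr.data_isVacuumConstraintSolution_zero M M)
      𝒟 hmax
  exact ⟨(key 1 one_pos).1, fun η hη ↦ (key η hη).2⟩

/-! ## §4 Degenerate centres: the parameter clause alone is consistent -/

/-- **The pinning kills do not port.** Whenever `|a| ≤ M` — in particular at the EXTREMAL centre
`|a| = M` and at the MASSLESS centre `M = 0`, `a = 0` — the parameter clause of the conclusion,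
"some sub-extremal `(M', a')` with `|M' − M| + |a' − a| ≤ η`", is satisfiable for every `η > 0`
(witness `(M + η/2, a)`). So under the `∀ η ∃ ε` typing the degenerate centres that refute the
closed-range and massless members of the predecessor family by pinning
(`BulkKerrCapture.Negative.captureAt_noMGHD_of_not_isSubextremal`) are no longer contradictory on
their face: refuting those members of the `C²` family needs LIMIT RIGIDITY (§5). [folklore] -/
theorem subextremal_near_of_abs_le {M a η : ℝ} (ha : |a| ≤ M) (hη : 0 < η) :
    ∃ M' a' : ℝ, Kerr.IsSubextremal M' a' ∧ |M' - M| + |a' - a| ≤ η := by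
  refine ⟨M + η / 2, a, ?_, ?_⟩
  · unfold Kerr.IsSubextremal
    linarith
  · rw [sub_self, abs_zero, add_zero, add_sub_cancel_left, abs_of_pos (by positivity)]
    linarith

/-- **Only a SUPER-extremal centre is excluded by counting**: if `M + η < |a|` then no
sub-extremal `(M', a')` is within `η` of `(M, a)`. [folklore] -/
theorem not_exists_subextremal_near_of_lt {M a η : ℝ} (h : M + η < |a|) :
    ¬ ∃ M' a' : ℝ, Kerr.IsSubextremal M' a' ∧ |M' - M| + |a' - a| ≤ η := by
  rintro ⟨M', a', hsub, hpar⟩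
  unfold Kerr.IsSubextremal at hsub
  have h1 : M' ≤ M + |M' - M| := by linarith [le_abs_self (M' - M)]
  have h2 : |a| ≤ |a'| + |a' - a| := by
    have := abs_sub_abs_le_abs_sub a a'
    rw [abs_sub_comm] at this
    linarith
  linarith

end Summit.FinalStateConjecture.FinalStateConjecture.Theorems.BulkKerrCaptureC2.Negative

end
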